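import Summits.QuantumFields.YangMills.Theorems.BalabanUVNodesN07SplitClauseHeadKnitMeetNormalisedTowerW
import Summits.QuantumFields.YangMills.Theorems.BalabanUVNodesN07SplitClauseHeadKnitRanged
import Summits.QuantumFields.YangMills.Theorems.BalabanUVNodesN07SplitClauseLevelRaisingMarginWide
import Summits.QuantumFields.YangMills.Theorems.BalabanUVNodesN07SplitClauseHeadKnitMeetNormalised
import Summits.QuantumFields.YangMills.Theorems.BalabanUVNodesN07SplitClauseHeadAtMeetCubeFarW
import Summits.QuantumFields.YangMills.Theorems.BalabanUVNodesN07MeetFamilyAtRecord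
import Summits.QuantumFields.YangMills.Theorems.BalabanUVNodesN07ShearSizeTopBox
import Literature.MathematicalPhysics.QuantumFieldTheory.Balaban1983to89.Node00.DomainsRefinement
import HarnessLib

/-!
# N07 [B11] (= [15] = [Balaban1985Variational]) Sect. F, S6 HEAD — MODULE 77c⁗ (plan g93 WORD A3⁵ = ρ3 ∕ director №310 (ii); head re-cut step 1 of 4: 77c⁗ → 89⁗ → 90⁗ → 100⁗): THE MEET KNIT
# **EDITION 77c⁵ (W152E) — THE NORMALISATION PREDICATE `Nrm` IS INDEXED BY THE TOLERANCE SEQUENCE `ε`** (`Nrm ν M g K k s ε U j idx u A`): ✓p744384 (77c⁗) VERBATIM except the type of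
# `Nrm` gains `(ℕ → ℝ) →` and its two application sites pass `ε` — so that a premise whose normalisation row holds up to a LEVEL-DEPENDENT defect `Ψ ε j` (№311a (β): ψ₂ = C·θ_j·κε_j,
# ε²-type) can be knit; the chart's (c′) coefficient then stays absorbable by the budget row (n07-e ⚑ I.30825).  Everything below this line is 77c⁗'s header.

# UNDER PRINT's NORMALISED LANDAU GAUGE, **(152)-COMPLETE TOWER EDITION WITH THE SEAM (R4)**, normalisation currency ABSTRACT (`Nrm`; of record: MODULE 87's `NrmSymOfRecord`):
# MODULE 77c (`…HeadKnitMeetNormalisedTowerW`) VERBATIM except (i) HS3NORM-67c's tower block carries print's (152) SECOND member (T2b) `‖∇^η_νA_μ‖ < κ·ε_j·L^{2(j−j′)}` on every `π″□_{j′}`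
# (⚑ LOCATED-DPRIME-T2-GRADIENT, repair (R-a)); (ii) ONE new displayed hypothesis HSEAM = (R4) «the record's minimiser is print-critical in cell form on the (2.3) cells of `domainsOfSeq s.Ω k`» (the cell
# data themselves are DERIVED from `AgreeOn (genSet …)` by `Node00.mem_bondsOf_genSet_of_lamBond_domainsOfSeq`) (⚑ LOCATED-DPRIME-CALIBRATION: under reading (b) NOT derivable from `IsCritOnFibre … (genSet s.Ω k) …`; a theorem after the (ii)-edition); (iii) HCHART-
# MEET-NORM receives, besides 77c's binders, the cell data of HSEAM and (T2b) — exactly the premises of the (d′) supplier `hA1_lam` (MODULE 117)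

Cell `pub-ymgap`, seat `pub-ymgap-dag-n07-e` g30 (FAN-OUT §N07 row s3; LANE OWNER of the K0 road chart side); head re-cut step 1 of 4 under plan g93 WORD (R-a) = «GO ON CONTENT» and A3⁵.  `--kind proof --supports stmt-QuantumFields-20541 --as helper` (K0⁷); count-neutral; def-free; ONE theorem; 77c stays in the tree as the resting state.
[15] = [Balaban1985Variational]; [6] = [Balaban1985RegularSpaces]; [4] = [Balaban1984PropagatorsII]; [I] = [Balaban1987RG1].

WHAT IS PROVED (sorry-free; no definition; axioms standard).  ★★★ `datumGaugeSplitTopStepCoreG_of_normalisedGauge_of_chartMeetTowerW152 (F N)` — 77c's statement with the three textual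
changes above; proof = 77c's VERBATIM (the width-generic margin reduction `datumGaugeSplitTopStepCoreG_of_marginCleanPrint`, the datum numerics, FILE D0, 77a's
`localGaugeSplitOn_head159_meetCube_box_farW` at zero shear), the new binders merely THREADED from HS3NORM ∕ HSEAM to HCHART.
HONEST SCOPE.  HS3NORM-152, HSEAM, HCHART, HLETTERS-NORM, HBUDGET-NORM are HYPOTHESES — displayed, NOT discharged; nothing of [15]∕[6]∕[4] ANALYSIS asserted; NO stub registered or
closed; K0⁷ ∕ K1⁹ NOT closed; N07 NOT discharged; counts unmoved (typed 28∕28 · discharged 8∕27 per the chair); one finite 𝕋⁴ programme at fixed ε — the route closes the conditional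
finite-𝕋⁴ rung `BalabanLadder.UV` ONLY; the YM mass gap (Clay) is NOT proved by any of this; nothing continuum ∕ ℝ⁴ ∕ OS.  No `sorry`, no `def`, no `instance`, no `notation`.

References: [15] (144) p. 300, (147)–(156) pp. 301–302, (157)–(159) pp. 302–303, (160)–(166) pp. 303–304, (168) p. 304, Prop. 8 p. 304; [6] Thm. 2 p. 83, p. 98, Prop. 6 (1.135)–(1.138)
p. 99, (1.29) p. 81, (1.3)–(1.9) p. 77, (1.131) p. 99; [4] (2.1)–(2.4) p. 224, Cor. 2.8 p. 249; [I] (0.1) p. 251.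
-/

set_option autoImplicit false

noncomputable section
open scoped BigOperators Matrix.Norms.L2Operator

namespace Summit.QuantumFields.YangMills.BalabanUVNodes.N07SplitClauseHeadKnitMeetNormalisedTowerW152E

open Literature.MathematicalPhysics.QuantumFieldTheory.Balaban1983to89
open Literature.MathematicalPhysics.QuantumFieldTheory.Balaban1983to89.Node00
open Literature.MathematicalPhysics.QuantumFieldTheory.Balaban1983to89.B15DeterminingSets
open Literature.MathematicalPhysics.QuantumFieldTheory.Balaban1983to89.B12RegularSpaces111 (gaugeU expI grad)
open B15Eq112TorusCover (cover)
open B14DomainGeom (Pt Within)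
open B14.Eq213MaximalDomains (side cubeExt)
open B5Eq117TorusCarriers (Mk)
open B5Eq118OneStroke (iterBlockOf)
open B5Prop12FieldsLattice (distSite)
open B8Eq131Cubes (sqLo sqHi box cube)
open B8LeafModelZd (ZdIdx)
open B11Eq115Space (levOf)
open B6SectADomainsV1 (Domains)
open B6SectAOperatorsV1 (BondIdx RE dsE QpE)
open Literature.MathematicalPhysics.QuantumFieldTheory.BalabanImbrieJaffe1984to88.BIJ85AxialPropagator411 (BondSpace)
open T4Continuum (T4Family)
open T4AxialGaugeSmallField (castSite)
open B16Sect1Backgrounds (toMS)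
open GaugeField (gaugeAct)
open MatrixLog (mlog)
open Summit.QuantumFields.YangMills.Theorems.K0FlatCubeOpsTextP (flatH)
open Summit.QuantumFields.YangMills.BalabanUVNodes.N07HalvingStepTopOfLocalLetters (Letters10On)
open Summit.QuantumFields.YangMills.BalabanUVNodes.N07LocalLettersSplitCore (LocalGaugeSplitOn)
open Summit.QuantumFields.YangMills.BalabanUVNodes.N07LocalLettersCoreGuarded (DatumGaugeSplitTopStepCoreG)
open Summit.QuantumFields.YangMills.BalabanUVNodes.N07SplitClauseHeadAtMeetCubeFarW (localGaugeSplitOn_head159_meetCube_box_farW)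
open Summit.QuantumFields.YangMills.BalabanUVNodes.N07MeetFamilyAtRecord (adm22_meetCube_trunc_seqOfRecord cover_mem_Ω_pred_of_meet_box)
open Summit.QuantumFields.YangMills.BalabanUVNodes.N07RecordDomainsAdm22 (blockSat_seqOfRecord)
open Summit.QuantumFields.YangMills.BalabanUVNodes.N07DatumGauge152Guarded (numerics_cornerP_of_levelGuard)
open Summit.QuantumFields.YangMills.BalabanUVNodes.N07SplitClauseLevelRaisingMarginWide (datumGaugeSplitTopStepCoreG_of_marginCleanPrint)
open Summit.QuantumFields.YangMills.BalabanUVNodes.N07SplitClauseHeadKnitMeetNormalised (grad_zero_fun split159_of_zero_shear)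
open Summit.QuantumFields.YangMills.BalabanUVNodes.N07ShearSizeTopBox (dist1_iter_avOfRecord_gaugeAct_one dist1_iter_avOfRecord_one)

/-! ## §1  The knit under the normalised gauge -/

open scoped Classical in
/-- ★★★ **THE MEET KNIT UNDER PRINT's NORMALISED LANDAU GAUGE, (152)-COMPLETE TOWER EDITION WITH THE SEAM** (statement in the header; MODULE 77c with (T2b) in HS3NORM, the displayed
seam HSEAM, and HCHART-MEET-NORM receiving the cell data and (T2b); everything else byte-identical): the guarded per-datum token `DatumGaugeSplitTopStepCoreG F N suppDom Mc ρ Adm B₃ C θ Q κ a₀ a₁`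
for every guard `Adm` implying the V20-G conjuncts and the run's grid numerics, every letter `κ ≥ 0`, and every normalisation predicate `Nrm`, modulo the displayed HS3NORM-152, HSEAM,
HCHART-MEET-NORM-152, HLETTERS-NORM and HBUDGET-NORM.
[cite: Balaban1985Variational, (144) p.300, (147)–(156) pp.301–302, (157)–(159) pp.302–303, (160)–(166) pp.303–304, (168) p.304, Prop. 8 p.304; Balaban1985RegularSpaces, Thm. 2 p.83, (1.29) p.81, p.98 (□̃, □_j), Prop. 6 (1.135)–(1.138) p.99, (1.131) p.99; Balaban1984PropagatorsII, (2.1)–(2.4) p.224, Cor. 2.8 (2.150)–(2.151) p.249] -/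
theorem datumGaugeSplitTopStepCoreG_of_normalisedGauge_of_chartMeetTowerW152E (F : T4Family) (N : ℕ) [NeZero N] :
    ∃ (Mh₀ R₀ : ℕ) (CH δH BH : ℝ), 0 ≤ CH ∧ 0 < δH ∧ 0 < BH ∧
    ∀ {ρ : ℕ}
      -- structural letters: grid cube `Mc`, block height `a′` (`M_h = L^{a′} ≥ M_h⁰`), `R ≥ R₀`, the collar `ρ` with `L·M_h ∣ ρ`, `R·L·M_h ≤ ρ`, `L ≤ ρ`
      {Mc Mh R a' : ℕ} (_ : 1 ≤ Mc) (_ : Mc ≤ ρ) (_ : Mh = F.L ^ a') (_ : Mh₀ ≤ Mh) (_ : R₀ ≤ R) (_ : F.L * Mh ∣ ρ) (_ : R * (F.L * Mh) ≤ ρ) (hLρ : F.L ≤ ρ)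
      -- the two constants of the plan's V20-G guard `c ≤ ν.M₁ ∧ k + c₀ ≤ F.m + K` and their side conditions (as in FILE D)
      {c c₀ : ℕ} (_ : (11 * 4 + 4 * ρ + Mc + 3) * F.L ≤ c) (_ : Mc + 11 * 4 + 6 * ρ ≤ 2 * F.L ^ c₀) (_ : F.m ≤ c₀) (_ : a' + 3 ≤ c₀)
      -- ★ THE GUARD: any step guard implying the V20-G conjuncts AND the run's grid numerics the meet's (2.1) needs (`hgran`, `hdiv`)
      (Adm : StepGuard F) (_ : ∀ (ν : Stage7Numerics) (M : ℕ) (g : ℕ → ℝ) (K k : ℕ) (s : SeqOfRecord F ν M g K k), Adm ν M g K k s → c ≤ ν.M₁ ∧ k + c₀ ≤ F.m + K)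
      (_ : ∀ (ν : Stage7Numerics) (M : ℕ) (g : ℕ → ℝ) (K k : ℕ) (s : SeqOfRecord F ν M g K k), Adm ν M g K k s → ∀ j : ℕ, 1 ≤ j → j ≤ k →
        F.L * Mh ∣ M * RkOfRecord (F.P K).L ν.r (g j) ∧ dCubeSide (F.P K).L M (RkOfRecord (F.P K).L ν.r (g j)) j ∣ (F.P K).sitesPerDir 0)
      -- the token's letters, `0 < B₃`, the FREE (152)-letter `κ ≥ 0`, the (163)-type letter `θ_H` of the `H` doors
      {B₃ C θ Q κ a₀ a₁ θH : ℝ} (_ : 0 < B₃) (_ : 0 ≤ C) (_ : 0 ≤ θ) (_ : 0 ≤ Q) (_ : 0 ≤ κ) (_ : 8 * CH * BH * Real.exp (-(δH * (ρ : ℝ))) ≤ θH)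
      -- the chart side's PER-LEVEL SIZE LETTERS, functions of the letters `(ε, δ)` and the level only — NO shear letters `σ ∕ v ∕ av`
      (β₁ β₂ s' t₁ : (ℕ → ℝ) → (ℕ → ℝ) → ℕ → ℝ)
      -- ★ HLETTERS-NORM (RANGED): signs only, IN THE TOKEN's RANGE `0 < δ_j ≤ a₁`, `B₃δ_j ≤ ε_j ≤ a₀`
      (_ : ∀ (ε δ : ℕ → ℝ) (j : ℕ), 0 < δ j → δ j ≤ a₁ → B₃ * δ j ≤ ε j → ε j ≤ a₀ → 0 ≤ β₁ ε δ j ∧ 0 ≤ β₂ ε δ j ∧ 0 ≤ s' ε δ j)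
      -- ★ HBUDGET-NORM (RANGED): thresholds above FILE C's two floors summing STRICTLY below the token's threshold — no `t_D`, no `C_S·B_S`
      (_ : ∀ (K : ℕ) (ε δ : ℕ → ℝ) (j : ℕ), 0 < δ j → δ j ≤ a₁ → B₃ * δ j ≤ ε j → ε j ≤ a₀ → ∃ t₂ t₃ : ℝ,
        1 / 4 * ((sideP (F.P K) Mc ρ : ℕ) : ℝ) * max (4 * CH * BH * β₁ ε δ j) (θH * β₂ ε δ j) < t₂ ∧ 2 * CH * BH * s' ε δ j < t₃ ∧
        t₁ ε δ j + t₂ + t₃ < C * δ j + θ * ε j + Q * ε j ^ 2)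
      -- ★ HSEAM = (R4): the record's minimiser is PRINT-CRITICAL in cell form on the (2.3) cells of `domainsOfSeq s.Ω k` (its averages there ARE the data: derived from `AgreeOn (genSet …)`) (⚑ LOCATED-DPRIME-CALIBRATION's seam; under
      --   reading (b) NOT derivable from `IsCritOnFibre … (genSet s.Ω k) …`; a theorem after the (ii)-edition) — displayed, NOT discharged
      (_ : ∀ (ν : Stage7Numerics) (M : ℕ) (g : ℕ → ℝ) (K k : ℕ) (s : SeqOfRecord F ν M g K k), Sect2.SeqSeparated ν.M₁ s → 0 < ν.M₁ →
        Adm ν M g K k s → 1 ≤ k →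
        ∀ (δ : ℕ → ℝ),
        ∀ W : MSField (F.P K) (SU N), Sect2.DataSmall7PTop (avOfRecord F N K) s.Ω (suppDomOfRecord F ν K s.Ω) k δ W →
        ∀ U : GaugeField (F.P K) 0 (SU N),
        AgreeOn (genSet s.Ω k) (avgFamily (avOfRecord F N K) U) W → IsCritOnFibre F N K (genSet s.Ω k) W U →
        ∀ (hkk : k ≤ (F.P K).m + (F.P K).K),
        ∀ γ : ℝ → GaugeField (F.P K) 0 (SU N), γ 0 = U →
          DifferentiableAt ℝ (fun (t : ℝ) (b : PBond (F.P K) 0) => ((γ t b : SU N) : Matrix (Fin N) (Fin N) ℂ)) 0 →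
            (∀ᶠ t in nhds (0 : ℝ), ∀ (j : ℕ) (c : PBond (F.P K) j), (domainsOfSeq s.Ω k hkk).LamBond j c →
              avgFamily (avOfRecord F N K) (γ t) j c = W j c) →
              ∀ a : ℝ, HasDerivAt (fun t => wilsonAction4 (γ t)) a 0 → a = 0)
      -- ★ THE NORMALISATION PREDICATE (abstract): print's «`ū_j = 1` on `Λ′_j`» in the record currency the S3 pens and the chart lane agree
      (Nrm : ∀ (ν : Stage7Numerics) (M : ℕ) (g : ℕ → ℝ) (K k : ℕ), SeqOfRecord F ν M g K k → (ℕ → ℝ) → GaugeField (F.P K) 0 (SU N) → ℕ → Pt (F.P K).d →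
        GaugeTransf (F.P K) 0 (SU N) → (PBond (F.P K) 0 → MatA N) → Prop)
      -- ★ HS3NORM-67c: [6] Thm. 2's NORMALISED local Landau gauge at every MEETING, PRINT-MARGIN-CLEAN datum — (152) on the whole TOWER (gauge equation on `□₀`, level-weighted letters
      --   `< κ·ε_j·L^{j−j′}` on `□_{j′}`), the print-box letters `< κ·ε_j`, (153) for the MEET sequence, and `Nrm`
      (_ : ∀ (ν : Stage7Numerics) (M : ℕ) (g : ℕ → ℝ) (K k : ℕ) (s : SeqOfRecord F ν M g K k), Sect2.SeqSeparated ν.M₁ s → 0 < ν.M₁ →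
        Adm ν M g K k s → 1 ≤ k →
        ∀ (ε δ : ℕ → ℝ),
        (∀ n, n ≤ k → 0 < δ n ∧ δ n ≤ a₁) → (∀ n, n < k → δ n ≤ 2 * δ (n + 1)) → (∀ n, n < k → δ (n + 1) ≤ 2 * δ n) →
        (∀ n, n ≤ k → B₃ * δ n ≤ ε n ∧ ε n ≤ a₀) → (∀ n, n < k → ε n ≤ 2 * ε (n + 1)) → (∀ n, n < k → ε (n + 1) ≤ 2 * ε n) →
        ∀ W : MSField (F.P K) (SU N), Sect2.DataSmall7PTop (avOfRecord F N K) s.Ω (suppDomOfRecord F ν K s.Ω) k δ W →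
        ∀ U : GaugeField (F.P K) 0 (SU N),
        (∀ n, n ≤ k → PlaqSmallOn (Sect2.omegaPlaqsTop s.Ω (suppDomOfRecord F ν K s.Ω) n) (ε n * (F.P K).eta n ^ 2) U) →
        (∀ n, n ≤ k → Sect2.CoDivSmallOn (Sect2.omegaBondsTop s.Ω (suppDomOfRecord F ν K s.Ω) n) (ε n * (F.P K).eta n ^ 3) U) →
        AgreeOn (genSet s.Ω k) (avgFamily (avOfRecord F N K) U) W → IsCritOnFibre F N K (genSet s.Ω k) W U →
        ∀ (n : ℕ) (hk : K - n ≤ (F.P K).m + (F.P K).K), 1 ≤ K - n → K - n ≤ k → ∀ (idx : Pt (F.P K).d),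
        (∃ x ∈ box (F.P K).L (cornerP (F.P K) Mc ρ idx) (sideP (F.P K) Mc ρ) (K - n), ∃ y : Pt (F.P K).d, cover (F.P K) y ∈ s.Ω (K - n) ∧ Within ((3 : ℕ) : ℤ) x y) →
        (K - n = k ∨ ∀ z ∈ box (F.P K).L (cornerP (F.P K) Mc ρ idx - ((2 * ρ : ℕ) : Pt (F.P K).d)) (sideP (F.P K) Mc ρ + 2 * (2 * ρ)) (K - n),
          cover (F.P K) z ∉ s.Ω (K - n + 1)) →
        ∃ (u : GaugeTransf (F.P K) 0 (SU N)) (A : PBond (F.P K) 0 → MatA N),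
        (∀ b ∈ (Sect2.regionOfSet (F.P K) (cover (F.P K) '' box (F.P K).L (cornerP (F.P K) Mc ρ idx) (sideP (F.P K) Mc ρ) (K - n))).bonds,
          gaugeU (fun x => ιSU N (u x)) (fun b' => ιSU N (U b')) b = expI ((F.P K).eta (K - n)) (A b)) ∧
        -- (T1) the gauge equation on the WHOLE TOWER `□₀` of the datum ([6] p. 98, (1.131))
        (∀ b ∈ (Sect2.regionOfSet (F.P K) (cover (F.P K) '' cube (F.P K).L (cornerP (F.P K) Mc ρ idx) (sideP (F.P K) Mc ρ) ρ (K - n) 0)).bonds,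
          gaugeU (fun x => ιSU N (u x)) (fun b' => ιSU N (U b')) b = expI ((F.P K).eta (K - n)) (A b)) ∧
        -- (T2) (152)'s LEVEL-WEIGHTED letters on every `□_{j′}`, `j′ ≤ K − n`
        (∀ j', j' ≤ K - n →
          ∀ b ∈ (Sect2.regionOfSet (F.P K) (cover (F.P K) '' cube (F.P K).L (cornerP (F.P K) Mc ρ idx) (sideP (F.P K) Mc ρ) ρ (K - n) j')).bonds,
            ‖A b‖ < κ * ε (K - n) * ((F.P K).L : ℝ) ^ (K - n - j')) ∧
        (∀ j', j' ≤ K - n →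
          ∀ q ∈ (Sect2.regionOfSet (F.P K) (cover (F.P K) '' cube (F.P K).L (cornerP (F.P K) Mc ρ idx) (sideP (F.P K) Mc ρ) ρ (K - n) j')).dpairs,
            ‖grad ((F.P K).eta (K - n)) q.2.1 (fun y => A ⟨y, q.2.2⟩) q.1‖ < κ * ε (K - n) * ((F.P K).L : ℝ) ^ (2 * (K - n - j'))) ∧
        (∀ b ∈ (Sect2.regionOfSet (F.P K) (cover (F.P K) '' box (F.P K).L (cornerP (F.P K) Mc ρ idx) (sideP (F.P K) Mc ρ) (K - n))).bonds,
          ‖A b‖ < κ * ε (K - n)) ∧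
        (∀ q ∈ (Sect2.regionOfSet (F.P K) (cover (F.P K) '' box (F.P K).L (cornerP (F.P K) Mc ρ idx) (sideP (F.P K) Mc ρ) (K - n))).dpairs,
          ‖grad ((F.P K).eta (K - n)) q.2.1 (fun y => A ⟨y, q.2.2⟩) q.1‖ < κ * ε (K - n)) ∧
        (∀ b ∈ Sect2.bondsDeep (cover (F.P K) '' box (F.P K).L (cornerP (F.P K) Mc ρ idx) (sideP (F.P K) Mc ρ) (K - n)),
          ‖Sect2.codiffCurlA ((F.P K).eta (K - n)) A b.src b.dir‖ < κ * ε (K - n)) ∧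
        (∀ b ∈ Sect2.bondsDeep (cover (F.P K) '' box (F.P K).L (cornerP (F.P K) Mc ρ idx) (sideP (F.P K) Mc ρ) (K - n)),
          ‖∑ ν' : Fin (F.P K).d, (((F.P K).eta (K - n) : ℝ) : ℂ)⁻¹ •
              (grad ((F.P K).eta (K - n)) ν' (fun y => A ⟨y, b.dir⟩) (b.src.unshift ν') - grad ((F.P K).eta (K - n)) ν' (fun y => A ⟨y, b.dir⟩) b.src)‖ <
            κ * ε (K - n)) ∧
        (∀ D' : Domains (F.P K), LinearMap.ker (QpE D') ≤
            LinearMap.ker (QpE (domainsMeet (cubeDomains (F.P K) (cornerP (F.P K) Mc ρ idx) (sideP (F.P K) Mc ρ) ρ (K - n) hk) (domainsOfSeq s.Ω (K - n) hk))) →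
          ∀ φ : MatA N →L[ℂ] ℂ,
          RE D' ((F.P K).eta (K - n))⁻¹ (dsE ((F.P K).eta (K - n))⁻¹ (WithLp.toLp 2 fun b => (φ (A b)).re : BondSpace (F.P K))) = 0 ∧
          RE D' ((F.P K).eta (K - n))⁻¹ (dsE ((F.P K).eta (K - n))⁻¹ (WithLp.toLp 2 fun b => (φ (A b)).im : BondSpace (F.P K))) = 0) ∧
        Nrm ν M g K k s ε U (K - n) idx u A)
      -- ★ HCHART-MEET-NORM-67c: the chart lane's per-datum deliverable at PRINT's (150) FAMILY `D″` UNDER THE NORMALISED GAUGE — print's (154)–(159), shear-free — now GIVEN (152) on the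
      --   whole tower ((T1) gauge equation on `□₀`, (T2) level-weighted letters on every `□_{j′}`): the FAR row is LEVEL-WEIGHTED (print (152) with (156)–(157)) — free from (T2) (`B c := Q_c(A)`, MODULE 78)
      (_ : ∀ (ν : Stage7Numerics) (M : ℕ) (g : ℕ → ℝ) (K k : ℕ) (s : SeqOfRecord F ν M g K k), Sect2.SeqSeparated ν.M₁ s → 0 < ν.M₁ →
        Adm ν M g K k s → 1 ≤ k →
        ∀ (ε δ : ℕ → ℝ),
        (∀ n, n ≤ k → 0 < δ n ∧ δ n ≤ a₁) → (∀ n, n < k → δ n ≤ 2 * δ (n + 1)) → (∀ n, n < k → δ (n + 1) ≤ 2 * δ n) →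
        (∀ n, n ≤ k → B₃ * δ n ≤ ε n ∧ ε n ≤ a₀) → (∀ n, n < k → ε n ≤ 2 * ε (n + 1)) → (∀ n, n < k → ε (n + 1) ≤ 2 * ε n) →
        ∀ W : MSField (F.P K) (SU N), Sect2.DataSmall7PTop (avOfRecord F N K) s.Ω (suppDomOfRecord F ν K s.Ω) k δ W →
        ∀ U : GaugeField (F.P K) 0 (SU N),
        (∀ n, n ≤ k → PlaqSmallOn (Sect2.omegaPlaqsTop s.Ω (suppDomOfRecord F ν K s.Ω) n) (ε n * (F.P K).eta n ^ 2) U) →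
        (∀ n, n ≤ k → Sect2.CoDivSmallOn (Sect2.omegaBondsTop s.Ω (suppDomOfRecord F ν K s.Ω) n) (ε n * (F.P K).eta n ^ 3) U) →
        AgreeOn (genSet s.Ω k) (avgFamily (avOfRecord F N K) U) W → IsCritOnFibre F N K (genSet s.Ω k) W U →
        -- ★ the cell data of HSEAM: the data on the (2.3) CELLS of the record's family and PRINT's CELL-FORM CRITICALITY there
        ∀ (hkk : k ≤ (F.P K).m + (F.P K).K),
        (∀ (j : ℕ) (c : PBond (F.P K) j), (domainsOfSeq s.Ω k hkk).LamBond j c → avgFamily (avOfRecord F N K) U j c = W j c) →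
        (∀ γ : ℝ → GaugeField (F.P K) 0 (SU N), γ 0 = U →
          DifferentiableAt ℝ (fun (t : ℝ) (b : PBond (F.P K) 0) => ((γ t b : SU N) : Matrix (Fin N) (Fin N) ℂ)) 0 →
            (∀ᶠ t in nhds (0 : ℝ), ∀ (j : ℕ) (c : PBond (F.P K) j), (domainsOfSeq s.Ω k hkk).LamBond j c →
              avgFamily (avOfRecord F N K) (γ t) j c = W j c) →
              ∀ a : ℝ, HasDerivAt (fun t => wilsonAction4 (γ t)) a 0 → a = 0) →
        ∀ (n : ℕ) (hk : K - n ≤ (F.P K).m + (F.P K).K), 1 ≤ K - n → K - n ≤ k → ∀ (idx : Pt (F.P K).d),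
        -- MEETING DATUMS ONLY: the print box has a point within `3` of a lift of a site of `Ω_{K−n}`
        (∃ x ∈ box (F.P K).L (cornerP (F.P K) Mc ρ idx) (sideP (F.P K) Mc ρ) (K - n), ∃ y : Pt (F.P K).d, cover (F.P K) y ∈ s.Ω (K - n) ∧ Within ((3 : ℕ) : ℤ) x y) →
        -- PRINT-MARGIN-CLEAN DATUMS ONLY (print p. 300 + (144)'s margin cube «□̃» = the print box WIDENED BY `2ρ` BLOCKS): top level, or «□̃» misses `Ω_{j+1}`
        (K - n = k ∨ ∀ z ∈ box (F.P K).L (cornerP (F.P K) Mc ρ idx - ((2 * ρ : ℕ) : Pt (F.P K).d)) (sideP (F.P K) Mc ρ + 2 * (2 * ρ)) (K - n),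
          cover (F.P K) z ∉ s.Ω (K - n + 1)) →
        -- THE FAMILY: print's (150) `Ω′_j = □_j (j < k), Ω′_k = □_k ∩ Ω_k`
        ∀ {HVd : Domains (F.P K)}
          (_ : HVd = domainsMeet (cubeDomains (F.P K) (cornerP (F.P K) Mc ρ idx) (sideP (F.P K) Mc ρ) ρ (K - n) hk) (domainsOfSeq s.Ω (K - n) hk))
          (lo hi : ℕ → Pt (F.P K).d),
        lo 0 = (fun i => ((F.P K).L : ℤ) * (sqLo (F.P K).L (cornerP (F.P K) Mc ρ idx) ρ (K - n) 1 i - 1)) →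
        hi 0 = (fun i => ((F.P K).L : ℤ) * (sqHi (F.P K).L (cornerP (F.P K) Mc ρ idx) (sideP (F.P K) Mc ρ) ρ (K - n) 1 i + 1) + (((F.P K).L : ℤ) - 1)) →
        (∀ j', 1 ≤ j' → lo j' = sqLo (F.P K).L (cornerP (F.P K) Mc ρ idx) ρ (K - n) j' - 1) →
        (∀ j', 1 ≤ j' → hi j' = sqHi (F.P K).L (cornerP (F.P K) Mc ρ idx) (sideP (F.P K) Mc ρ) ρ (K - n) j' + 1) →
        ∃ HV : (BondIdx HVd → MatA N) →ₗ[ℂ] (PBond (F.P K) 0 → MatA N),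
          (∀ (Bf : BondIdx HVd → MatA N) (b : PBond (F.P K) 0), HV Bf b = ∑ c, ((flatH (F.P K) (K - n) HVd (Pi.single c 1) b : ℝ) : ℂ) • Bf c) ∧
        ∀ (u : GaugeTransf (F.P K) 0 (SU N)) (A : PBond (F.P K) 0 → MatA N),
        (∀ b ∈ (Sect2.regionOfSet (F.P K) (cover (F.P K) '' box (F.P K).L (cornerP (F.P K) Mc ρ idx) (sideP (F.P K) Mc ρ) (K - n))).bonds,
          gaugeU (fun x => ιSU N (u x)) (fun b' => ιSU N (U b')) b = expI ((F.P K).eta (K - n)) (A b)) →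
        -- (T1) the gauge equation on the WHOLE TOWER `□₀` of the datum
        (∀ b ∈ (Sect2.regionOfSet (F.P K) (cover (F.P K) '' cube (F.P K).L (cornerP (F.P K) Mc ρ idx) (sideP (F.P K) Mc ρ) ρ (K - n) 0)).bonds,
          gaugeU (fun x => ιSU N (u x)) (fun b' => ιSU N (U b')) b = expI ((F.P K).eta (K - n)) (A b)) →
        -- (T2) (152)'s LEVEL-WEIGHTED letters on every `□_{j′}`, `j′ ≤ K − n`
        (∀ j', j' ≤ K - n →
          ∀ b ∈ (Sect2.regionOfSet (F.P K) (cover (F.P K) '' cube (F.P K).L (cornerP (F.P K) Mc ρ idx) (sideP (F.P K) Mc ρ) ρ (K - n) j')).bonds,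
            ‖A b‖ < κ * ε (K - n) * ((F.P K).L : ℝ) ^ (K - n - j')) →
        (∀ j', j' ≤ K - n →
          ∀ q ∈ (Sect2.regionOfSet (F.P K) (cover (F.P K) '' cube (F.P K).L (cornerP (F.P K) Mc ρ idx) (sideP (F.P K) Mc ρ) ρ (K - n) j')).dpairs,
            ‖grad ((F.P K).eta (K - n)) q.2.1 (fun y => A ⟨y, q.2.2⟩) q.1‖ < κ * ε (K - n) * ((F.P K).L : ℝ) ^ (2 * (K - n - j'))) →
        (∀ b ∈ (Sect2.regionOfSet (F.P K) (cover (F.P K) '' box (F.P K).L (cornerP (F.P K) Mc ρ idx) (sideP (F.P K) Mc ρ) (K - n))).bonds,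
          ‖A b‖ < κ * ε (K - n)) →
        (∀ q ∈ (Sect2.regionOfSet (F.P K) (cover (F.P K) '' box (F.P K).L (cornerP (F.P K) Mc ρ idx) (sideP (F.P K) Mc ρ) (K - n))).dpairs,
          ‖grad ((F.P K).eta (K - n)) q.2.1 (fun y => A ⟨y, q.2.2⟩) q.1‖ < κ * ε (K - n)) →
        (∀ b ∈ Sect2.bondsDeep (cover (F.P K) '' box (F.P K).L (cornerP (F.P K) Mc ρ idx) (sideP (F.P K) Mc ρ) (K - n)),
          ‖Sect2.codiffCurlA ((F.P K).eta (K - n)) A b.src b.dir‖ < κ * ε (K - n)) →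
        (∀ b ∈ Sect2.bondsDeep (cover (F.P K) '' box (F.P K).L (cornerP (F.P K) Mc ρ idx) (sideP (F.P K) Mc ρ) (K - n)),
          ‖∑ ν' : Fin (F.P K).d, (((F.P K).eta (K - n) : ℝ) : ℂ)⁻¹ •
              (grad ((F.P K).eta (K - n)) ν' (fun y => A ⟨y, b.dir⟩) (b.src.unshift ν') - grad ((F.P K).eta (K - n)) ν' (fun y => A ⟨y, b.dir⟩) b.src)‖ <
            κ * ε (K - n)) →
        (∀ D' : Domains (F.P K), LinearMap.ker (QpE D') ≤ LinearMap.ker (QpE HVd) → ∀ φ : MatA N →L[ℂ] ℂ,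
          RE D' ((F.P K).eta (K - n))⁻¹ (dsE ((F.P K).eta (K - n))⁻¹ (WithLp.toLp 2 fun b => (φ (A b)).re : BondSpace (F.P K))) = 0 ∧
          RE D' ((F.P K).eta (K - n))⁻¹ (dsE ((F.P K).eta (K - n))⁻¹ (WithLp.toLp 2 fun b => (φ (A b)).im : BondSpace (F.P K))) = 0) →
        -- ★ THE NORMALISATION of this `u` (print's «ū_j = 1 on Λ′_j»), as delivered by HS3NORM
        Nrm ν M g K k s ε U (K - n) idx u A →
        -- print's (154)–(159): the centre `x_c`, the DATA rows `B` ((160) near, centred; (152)∕(156)–(157) far, level-weighted), the small datum `B′`, the (158)∕(165) summand `A₁`, and `A = A₁ + H_V B − H_V B′`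
        ∃ (xc : Pt (F.P K).d) (B B' : BondIdx HVd → MatA N) (A₁ : PBond (F.P K) 0 → MatA N),
          xc ∈ box (F.P K).L (cornerP (F.P K) Mc ρ idx) (sideP (F.P K) Mc ρ) (K - n) ∧
          (∀ c : BondIdx HVd, ((c.1.1 : ℕ) = K - n ∨
              (blockOf c.1.2.src ∈ (cubeDomains (F.P K) (cornerP (F.P K) Mc ρ idx) (sideP (F.P K) Mc ρ) ρ (K - n) hk).Om ((c.1.1 : ℕ) + 1) ∧
                blockOf c.1.2.tgt ∈ (cubeDomains (F.P K) (cornerP (F.P K) Mc ρ idx) (sideP (F.P K) Mc ρ) ρ (K - n) hk).Om ((c.1.1 : ℕ) + 1))) →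
            ‖B c‖ ≤ β₁ ε δ (K - n) * (distSite (Mk (F.P K) (c.1.1 : ℕ)) c.1.2.src (iterBlockOf (c.1.1 : ℕ) (cover (F.P K) xc)) + 1)) ∧
          (∀ c : BondIdx HVd, ¬ ((c.1.1 : ℕ) = K - n ∨
              (blockOf c.1.2.src ∈ (cubeDomains (F.P K) (cornerP (F.P K) Mc ρ idx) (sideP (F.P K) Mc ρ) ρ (K - n) hk).Om ((c.1.1 : ℕ) + 1) ∧
                blockOf c.1.2.tgt ∈ (cubeDomains (F.P K) (cornerP (F.P K) Mc ρ idx) (sideP (F.P K) Mc ρ) ρ (K - n) hk).Om ((c.1.1 : ℕ) + 1))) →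
            ‖B c‖ ≤ β₂ ε δ (K - n) * ((ρ : ℝ) + ((sideP (F.P K) Mc ρ : ℕ) : ℝ)) * ((F.P K).L : ℝ) ^ ((K - n) - (c.1.1 : ℕ))) ∧
          (∀ c, ‖B' c‖ ≤ s' ε δ (K - n)) ∧
          Letters10On (cover (F.P K) '' box (F.P K).L (cornerP (F.P K) Mc ρ idx) (sideP (F.P K) Mc ρ) (K - n)) ((F.P K).eta (K - n)) (t₁ ε δ (K - n)) A₁ ∧
          (∀ b, A b = A₁ b + HV B b - HV B' b)),
      DatumGaugeSplitTopStepCoreG F N (fun ν K Ω => suppDomOfRecord F ν K Ω) Mc ρ Adm B₃ C θ Q κ a₀ a₁ := by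
  obtain ⟨Mh₀, R₀, CS, BS, CH, δH, BH, -, -, hCH, hδH, hBH, hmain⟩ := localGaugeSplitOn_head159_meetCube_box_farW F N
  refine ⟨Mh₀, R₀, CH, δH, BH, hCH, hδH, hBH, ?_⟩
  intro ρ Mc Mh R a' hMc hMcρ hMha hMh hR hdvd hRρ hLρ c c₀ hc hc₀ hmc₀ hac₀ Adm hAdm₁ hAdm₂ B₃ C θ Q κ a₀ a₁ θH hB₃ hC0 hθ0 hQ0 hκ0 h163
    β₁ β₂ s' t₁ hletters hbudget hseam Nrm hS3 hchart
  -- the width-generic margin level-raising reduction at PRINT's width `w = 2ρ` (MODULE 66): the clause is owed at PRINT-MARGIN-CLEAN datums whose print box MEETS `Ω_j`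
  refine datumGaugeSplitTopStepCoreG_of_marginCleanPrint F N hMc hMcρ hB₃.le hκ0 hC0 hθ0 hQ0 ?_
  intro ν M g K k s hsep hM₁ hadm hk ε δ hδ hcompδ hcompδ' hε hεcomp hεcomp' W h7 U h17 h19 hfib hcrit j hj hjk a hmeet hclean
  -- the guard's two halves: the V20-G conjuncts and the run's grid numerics
  have hV20 : c ≤ ν.M₁ ∧ k + c₀ ≤ F.m + K := hAdm₁ ν M g K k s hadm
  have hgrid := hAdm₂ ν M g K k s hadm
  -- the level guard with `F.m ≤ c₀` puts every datum level below `K`: write it as `K − n`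
  have hkK : k ≤ K := by have := hV20.2; omega
  obtain ⟨n, rfl⟩ : ∃ n, j = K - n := ⟨K - j, by omega⟩
  have hk1 : 1 ≤ K - n := hj
  have hkP : K - n ≤ (F.P K).m + (F.P K).K := by
    have : (F.P K).m + (F.P K).K = F.m + K := rfl
    omega
  have hLρ' : (F.P K).L ≤ ρ := hLρ
  -- the letters' ranges at the datum's level
  have hr1 : 0 < δ (K - n) := (hδ _ hjk).1
  have hr2 : δ (K - n) ≤ a₁ := (hδ _ hjk).2
  have hr3 : B₃ * δ (K - n) ≤ ε (K - n) := (hε _ hjk).1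
  have hr4 : ε (K - n) ≤ a₀ := (hε _ hjk).2
  obtain ⟨hβ₁, hβ₂, hs'⟩ := hletters ε δ (K - n) hr1 hr2 hr3 hr4
  obtain ⟨t₂, t₃, ht₂, ht₃, hsum⟩ := hbudget K ε δ (K - n) hr1 hr2 hr3 hr4
  -- ★ S3's NORMALISED gauge at this meeting, clean datum (HS3NORM), and the datum's numerics from the level guard
  obtain ⟨u, A, he, heT, hAT, hAT2, hA, hdA, hcd, hlap, h6, hnrm⟩ := hS3 ν M g K k s hsep hM₁ hadm hk ε δ hδ hcompδ hcompδ' hε hεcomp hεcomp' W h7 U h17 h19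
    hfib hcrit n hkP hk1 hjk a hmeet hclean
  -- the seam's cell data at this run
  have hkkP : k ≤ (F.P K).m + (F.P K).K := by have : (F.P K).m + (F.P K).K = F.m + K := rfl; omega
  have hcc := hseam ν M g K k s hsep hM₁ hadm hk δ W h7 U hfib hcrit hkkP
  have hUW : ∀ (j' : ℕ) (c' : PBond (F.P K) j'), (domainsOfSeq s.Ω k hkkP).LamBond j' c' → avgFamily (avOfRecord F N K) U j' c' = W j' c' :=
    fun j' c' hc' => hfib j' c' (mem_bondsOf_genSet_of_lamBond_domainsOfSeq s.Ω hkkP hk (fun i h1 hi => s.chain.Ω_succ_subset_Ω h1 hi)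
      (fun i x x' h1 hi => blockSat_seqOfRecord F ν M g K k hkkP s (fun i' h1' hi' => (hgrid i' h1' hi').2) i x x' h1 hi) hc')
  obtain ⟨ha, hM, hper, hinj⟩ := numerics_cornerP_of_levelGuard F hk1 hjk hV20.2 hMha (by omega) hLρ' hdvd hc₀ a
  have hρpos : 0 < ρ := lt_of_lt_of_le (F.P K).L_pos hLρ'
  have hM1 : 1 ≤ sideP (F.P K) Mc ρ := by have := le_sideP (P := F.P K) Mc hρpos; omega
  -- the canonical boxes of the datum's tower
  set lo : ℕ → Pt (F.P K).d := fun j' => if j' = 0 then (fun i => ((F.P K).L : ℤ) * (sqLo (F.P K).L (cornerP (F.P K) Mc ρ a) ρ (K - n) 1 i - 1))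
    else sqLo (F.P K).L (cornerP (F.P K) Mc ρ a) ρ (K - n) j' - 1 with hlo
  set hi : ℕ → Pt (F.P K).d := fun j' => if j' = 0 then
      (fun i => ((F.P K).L : ℤ) * (sqHi (F.P K).L (cornerP (F.P K) Mc ρ a) (sideP (F.P K) Mc ρ) ρ (K - n) 1 i + 1) + (((F.P K).L : ℤ) - 1))
    else sqHi (F.P K).L (cornerP (F.P K) Mc ρ a) (sideP (F.P K) Mc ρ) ρ (K - n) j' + 1 with hhi
  have hlo0 : lo 0 = fun i => ((F.P K).L : ℤ) * (sqLo (F.P K).L (cornerP (F.P K) Mc ρ a) ρ (K - n) 1 i - 1) := by simp [hlo]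
  have hhi0 : hi 0 = fun i => ((F.P K).L : ℤ) * (sqHi (F.P K).L (cornerP (F.P K) Mc ρ a) (sideP (F.P K) Mc ρ) ρ (K - n) 1 i + 1) + (((F.P K).L : ℤ) - 1) := by
    simp [hhi]
  have hloj : ∀ j', 1 ≤ j' → lo j' = sqLo (F.P K).L (cornerP (F.P K) Mc ρ a) ρ (K - n) j' - 1 := fun j' hj' => by
    simp [hlo, Nat.one_le_iff_ne_zero.mp hj']
  have hhij : ∀ j', 1 ≤ j' → hi j' = sqHi (F.P K).L (cornerP (F.P K) Mc ρ a) (sideP (F.P K) Mc ρ) ρ (K - n) j' + 1 := fun j' hj' => by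
    simp [hhi, Nat.one_le_iff_ne_zero.mp hj']
  -- THE RECORD SIDE OF THE MEET: nesting, block saturation (grid numerics), the window's collar «π(□) ⊆ Ω_{K−n−1}» (57a), and `Adm22 D″ R (L·M_h)` (FILE D0)
  have hnest : ∀ i : ℕ, 1 ≤ i → i < K - n → s.Ω (i + 1) ⊆ s.Ω i := fun i h1 hi => s.chain.Ω_succ_subset_Ω h1 (lt_of_lt_of_le hi hjk)
  have hdiv : ∀ j' : ℕ, 1 ≤ j' → j' ≤ K - n → dCubeSide (F.P K).L M (RkOfRecord (F.P K).L ν.r (g j')) j' ∣ (F.P K).sitesPerDir 0 :=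
    fun j' h1 hj' => (hgrid j' h1 (hj'.trans hjk)).2
  have hgran : ∀ j' : ℕ, 1 ≤ j' → j' ≤ K - n → F.L * Mh ∣ M * RkOfRecord (F.P K).L ν.r (g j') := fun j' h1 hj' => (hgrid j' h1 (hj'.trans hjk)).1
  have hsat : ∀ (j' : ℕ) (x x' : Site (F.P K) 0), 1 ≤ j' → j' ≤ K - n → iterBlockOf j' x = iterBlockOf j' x' → x ∈ s.Ω j' → x' ∈ s.Ω j' :=
    fun j' x x' h1 hj' => blockSat_seqOfRecord F ν M g K k (by have : (F.P K).m + (F.P K).K = F.m + K := rfl; omega) s (fun i h1 hi => (hgrid i h1 hi).2) j' x x' h1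
      (hj'.trans hjk)
  have hν1 : 1 ≤ ν.M₁ := hM₁
  have hfloor : 11 * (F.P K).d + 2 * ρ + Mc + 3 ≤ ν.M₁ := by
    have hd : (F.P K).d = 4 := rfl
    have hL1 : 1 ≤ F.L := by have := F.hL11; omega
    have : (11 * 4 + 4 * ρ + Mc + 3) ≤ (11 * 4 + 4 * ρ + Mc + 3) * F.L := Nat.le_mul_of_pos_right _ hL1
    rw [hd]; omega
  have hbox' : 2 ≤ K - n → ∀ z ∈ box (F.P K).L (cornerP (F.P K) Mc ρ a) (sideP (F.P K) Mc ρ) (K - n), cover (F.P K) z ∈ s.Ω (K - n - 1) :=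
    fun h2 => cover_mem_Ω_pred_of_meet_box F ν M g K k s hν1 hsep hfloor h2 hjk hmeet
  have hLMh : 1 ≤ F.L * Mh := by
    rw [hMha]
    exact Nat.one_le_iff_ne_zero.mpr (Nat.mul_ne_zero (by have := F.hL11; omega) (pow_ne_zero _ (by have := F.hL11; omega)))
  have hRsep : R * (F.L * Mh) + 1 ≤ (F.P K).L * ν.M₁ := by
    have hLP : (F.P K).L = F.L := rfl
    have hL1 : 1 ≤ F.L := by have := F.hL11; omega
    have h1 : ν.M₁ ≤ F.L * ν.M₁ := Nat.le_mul_of_pos_left _ hL1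
    have h2 : ρ + 1 ≤ c := by
      have : (11 * 4 + 4 * ρ + Mc + 3) ≤ (11 * 4 + 4 * ρ + Mc + 3) * F.L := Nat.le_mul_of_pos_right _ hL1
      omega
    rw [hLP]; omega
  have hAdmD := adm22_meetCube_trunc_seqOfRecord F ν M g K k s hjk hkP hLMh hν1 hRsep hsep hdiv hgran hdvd ha hM hper hRρ
  -- the chart side at this MEETING, CLEAN datum, at print's family, UNDER THE NORMALISED GAUGE: print's (154)–(159), no shear devices
  obtain ⟨HV, hHV, hch⟩ := hchart ν M g K k s hsep hM₁ hadm hk ε δ hδ hcompδ hcompδ' hε hεcomp hεcomp' W h7 U h17 h19 hfib hcrit hkkP hUW hcc n hkP hk1 hjk a hmeet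
    hclean rfl lo hi hlo0 hhi0 hloj hhij
  obtain ⟨xc, B, B', A₁, hxc, hX₁, hX₂, hB', h₁, h159⟩ := hch u A he heT hAT hAT2 hA hdA hcd hlap h6 hnrm
  -- FILE C at this datum AT ZERO SHEAR (`u_L := 1, U₁ := 1, λ := 0, X := 0, v := av := 0, σ := 0`, `t_D :=` the budget's slack), then the token's threshold exactly
  have hDσ : ∀ j' ≤ K - n, ((((F.P K).d * ((sideP (F.P K) Mc ρ + 4 * ρ + 3) * (F.P K).L ^ ((K - n) - j'))) : ℕ) : ℝ) * ((0 : ℝ) + 0) ≤ 0 :=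
    fun _ _ => by simp
  have hv : ∀ j' ≤ K - n, ∀ c' : PBond (F.P K) j', c'.src ∈ (castSite '' Set.Icc (lo j') (hi j') : Set (Site (F.P K) j')) →
      c'.tgt ∈ (castSite '' Set.Icc (lo j') (hi j') : Set (Site (F.P K) j')) →
        dist1 (Averaging.iter (avOfRecord F N K) j' (gaugeAct (fun _ => (1 : SU N)) (1 : GaugeField (F.P K) 0 (SU N))) c') ≤ (0 : ℝ) :=
    fun j' _ c' _ _ => dist1_iter_avOfRecord_gaugeAct_one F N K j' c'
  have hav : ∀ j' ≤ K - n, ∀ c' : PBond (F.P K) j', c'.src ∈ (castSite '' Set.Icc (lo j') (hi j') : Set (Site (F.P K) j')) →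
      c'.tgt ∈ (castSite '' Set.Icc (lo j') (hi j') : Set (Site (F.P K) j')) →
        dist1 (Averaging.iter (avOfRecord F N K) j' (1 : GaugeField (F.P K) 0 (SU N)) c') ≤ (0 : ℝ) :=
    fun j' _ c' _ _ => dist1_iter_avOfRecord_one F N K j' c'
  have hlam : ∀ (j' : ℕ) (y : Site (F.P K) j'), ‖(fun (_ : ℕ) (_ : Site (F.P K) j') => (0 : MatA N)) j' y‖ ≤
      ‖mlog (((((toMS (fun _ : Site (F.P K) 0 => (1 : SU N)) j' (castSite (lo j')))⁻¹ * toMS (fun _ : Site (F.P K) 0 => (1 : SU N)) j' y)⁻¹ : SU N)) : MatA N)‖ :=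
    fun _ _ => by rw [norm_zero]; exact norm_nonneg _
  have hX : ∀ c' : BondIdx (domainsMeet (cubeDomains (F.P K) (cornerP (F.P K) Mc ρ a) (sideP (F.P K) Mc ρ) ρ (K - n) hkP) (domainsOfSeq s.Ω (K - n) hkP)),
      (fun _ => (0 : MatA N)) c' = LatticeFieldCalculus.grad (((F.P K).L : ℝ) ^ (K - n) / ((F.P K).L : ℝ) ^ (c'.1.1 : ℕ))
        ((fun (_ : ℕ) (_ : Site (F.P K) _) => (0 : MatA N)) c'.1.1) c'.1.2 :=
    fun c' => (grad_zero_fun _ _).symm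
  have h159' : ∀ b, A b - HV (fun _ => (0 : MatA N)) b = A₁ b + HV B b - HV B' b := split159_of_zero_shear HV h159
  set tD : ℝ := C * δ (K - n) + θ * ε (K - n) + Q * ε (K - n) ^ 2 - (t₁ ε δ (K - n) + t₂ + t₃) with htD_def
  have htD : 2 * CS * BS * (4 * (0 : ℝ)) < tD := by
    have h0 : (0 : ℝ) < tD := sub_pos.mpr hsum
    simpa using h0
  have hclause := hmain n K hk1 (by omega) hkP hMha hMh hR (by omega) hM1 hLρ hinj s.Ω hnest hsat hbox' hAdmD hHV hxc hβ₁ hβ₂ h163 hX₁ hX₂ hs' hB'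
    hlo0 hhi0 hloj hhij (fun _ => (1 : SU N)) (1 : GaugeField (F.P K) 0 (SU N)) (fun _ => (0 : ℝ)) (fun _ => (0 : ℝ)) (fun _ => le_rfl) (fun _ => le_rfl)
    (by norm_num) hDσ hv hav (fun (_ : ℕ) (_ : Site (F.P K) _) => (0 : MatA N)) hlam hX u he hA hdA h₁ h159' ht₂ ht₃ htD
  exact hclause.of_le le_rfl (le_of_eq (by rw [htD_def]; ring))

end Summit.QuantumFields.YangMills.BalabanUVNodes.N07SplitClauseHeadKnitMeetNormalisedTowerW152E

end
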